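/-
Copyright (c) 2026 the pub-hodgecm-mathlib formalisation cell (harness21).  Prover seat hodgecm-mathlib-K2E5-p10 (g4), Track B «K2-LIT» ∕ h413
(`stmt-HodgeConjecture-24833`), line `K2_E3_EllipticInputs`, unit U12, §L road «U-iso-T» brick (G⁺-b)/(K3): THE `K`-AVERAGE OF A (det, entry)-WEIGHT OVER
THE BRUHAT CELLS — `∫_K Ω(det k, (k⁻¹Xk)₁₀) dκ = c (∫_𝒪 Ω(1, P_X(σ)) dσ + ∫_𝔭 Ω(−1, Q_X(t)) dt)`, `P_X`, `Q_X` the two cell quadratics of discriminant `disc χ_X`.  2026-09-04.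
-/
import Summits.HodgeConjecture.HodgeConjecture.Theorems.K2E3GL2IntegralPointsBruhatCells   -- ★ p857099 (K2E5-p17 (g3)): Haar on `GL₂(𝒪)` over the two Bruhat cells
import Literature.NumberTheory.Automorphic.LocalFieldHaarBalls                           -- ★ `normAbs` kit
import HarnessLib

/-!
# K2_E3 road (h413), §L brick (G⁺-b)/(K3) — the `K`-average of a (det, entry)-weight over the Bruhat cells

Cell `pub/hodgecm-mathlib` (D-0151), Track B, seat K2E5-p10 (g4) (E3 §L line; §L lead K2E3-p12 (g4); (G⁺-b) cut 2026-09-04T04:26Z: line side K2E5-p17 (g3),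
`K`-side this seat).  `--supports stmt-HodgeConjecture-24833 --as helper`; THEOREMS ONLY (no definition ∕ instance ∕ notation ∕ named fact ∕ `sorry`); never
imports `Cruxes/…/Lines`.  COUNT-NEUTRAL.

After ★ (K1) p857346 the `K`-side of (G⁺-b) is the evaluation of `K`-AVERAGES `A(X) = ∫_K Ω(det k, (k⁻¹ X k)₁₀) dκ(k)` of weights `Ω(d, s)` in the determinant and
the lower-left entry (for the unstable regular nilpotent combination: `Ω(d,s) = χ̃(a⁻¹d)·χ̃(s)·‖s‖⁻¹·1[‖s‖ ≥ q^{-2n}]`, split into its two non-negative parts).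
This file reduces `A(X)` to two ONE-DIMENSIONAL integrals over the cells of `K = GL₂(𝒪)` (★ p857099): if `Ω ≥ 0` is measurable and
`Ω(d·u, v·s) = Ω(d, s)` for units `u, v` with `u v` a square (the effect of right multiplication by `b = [[α,β],[0,δ]] ∈ B(𝒪)`: `det ↦ det·αδ`,
entry `↦ (α∕δ)·entry`), then with the cell constant `c` of ★ p857099
  `A(X) = c · (∫⁻_{σ ∈ 𝒪} Ω(1, P_X(σ)) dσ + ∫⁻_{t ∈ 𝔭} Ω(−1, Q_X(t)) dt)`,
  `P_X(σ) = (n⁻(σ)⁻¹ X n⁻(σ))₁₀ = X₁₀ + σ (X₁₁ − X₀₀) − σ² X₀₁`, `Q_X(t) = (m_t⁻¹ X m_t)₁₀ = X₀₁ + t (X₀₀ − X₁₁) − t² X₁₀` (`m_t = [[t,1],[1,0]]`),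
two quadratics of discriminant `disc χ_X` (**`lintegral_glInt_detEntryWeight_eq_cells`**).  §1: the two conjugation identities and `det n⁻(σ) = 1`, `det m_t = −1`;
§2: right-`B(𝒪)`-invariance of `k ↦ Ω(det k, (k⁻¹Xk)₁₀)`; §3 the cell formula.
[HarishChandra1999AdmissibleDistributions, §7] [LabesseLanglands1979, §2] [Gelbart1975, Remark 9.23]
HONEST LABEL: HC_CM is proved only modulo the 7 printed citations (2 remaining named inputs: hLiu418 = stmt-HodgeConjecture-24832, h413 =
stmt-HodgeConjecture-24833) until rung 0 closes; count-neutral helper toward (LBU-2⁺)∕(G⁺-b), NOT ★.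

## References
* [HarishChandra1999AdmissibleDistributions] Harish-Chandra (DeBacker–Sally), *Admissible Invariant Distributions on Reductive p-adic Groups* (1999), §7.
* [LabesseLanglands1979] J.-P. Labesse, R. P. Langlands, *L-indistinguishability for SL(2)*, Canad. J. Math. 31 (1979), §2.
* [Gelbart1975] S. Gelbart, *Automorphic forms on adele groups* (1975), Remark 9.23.
-/

set_option autoImplicit false
set_option linter.dupNamespace false   -- `Summit.HodgeConjecture.HodgeConjecture.…` (D-0017 nested layout; lakefile exemption for Summits)

noncomputable section

open MeasureTheory Measure Filter Topology Set
open scoped MatrixGroups NNReal ENNReal Pointwise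
open ValuativeRel
open Literature.NumberTheory.Rogawski1990 Literature.NumberTheory.Automorphic Literature.NumberTheory.Automorphic.LocalFieldHaar
open Literature.NumberTheory.GaloisRepresentations Literature.NumberTheory.GaloisRepresentations.IsNonarchimedeanLocalField
open Summit.HodgeConjecture.HodgeConjecture.Cruxes.H413.K2E3GL2IntegralPointsBruhatCells
open Summit.HodgeConjecture.HodgeConjecture.Cruxes.H413.K2E3GL2IntegralPointsCellLemmas

namespace Summit.HodgeConjecture.HodgeConjecture.Cruxes.H413.K2E3GL2TwistedWeightCells

variable {F : Type*} [Field F] [ValuativeRel F] [TopologicalSpace F] [IsNonarchimedeanLocalField F]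

/-! ## §1  The two cell representatives: inverses, determinants, lower-left entries of the conjugate -/

omit [ValuativeRel F] [TopologicalSpace F] [IsNonarchimedeanLocalField F] in
/-- `n⁻(σ)⁻¹ = [[1,0],[−σ,1]]`. [folklore] -/
theorem coe_lowerUni_inv (σ : F) :
    (((Matrix.GeneralLinearGroup.mkOfDetNeZero (!![1, 0; σ, 1] : Matrix (Fin 2) (Fin 2) F) (det_lowerUni_ne_zero σ))⁻¹ : GL (Fin 2) F) :
        Matrix (Fin 2) (Fin 2) F) = !![1, 0; -σ, 1] := by
  rw [Matrix.coe_units_inv]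
  refine Matrix.inv_eq_left_inv ?_
  show (!![1, 0; -σ, 1] : Matrix (Fin 2) (Fin 2) F) * !![1, 0; σ, 1] = 1
  ext i j
  fin_cases i <;> fin_cases j <;> simp [Matrix.mul_apply, Fin.sum_univ_two]

omit [ValuativeRel F] [TopologicalSpace F] [IsNonarchimedeanLocalField F] in
/-- `m_t⁻¹ = [[0,1],[1,−t]]` for `m_t = [[t,1],[1,0]]`. [folklore] -/
theorem coe_swapT_inv (t : F) :
    (((Matrix.GeneralLinearGroup.mkOfDetNeZero (!![t, 1; 1, 0] : Matrix (Fin 2) (Fin 2) F) (det_swapT_ne_zero t))⁻¹ : GL (Fin 2) F) :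
        Matrix (Fin 2) (Fin 2) F) = !![0, 1; 1, -t] := by
  rw [Matrix.coe_units_inv]
  refine Matrix.inv_eq_left_inv ?_
  show (!![0, 1; 1, -t] : Matrix (Fin 2) (Fin 2) F) * !![t, 1; 1, 0] = 1
  ext i j
  fin_cases i <;> fin_cases j <;> simp [Matrix.mul_apply, Fin.sum_univ_two]

omit [ValuativeRel F] [TopologicalSpace F] [IsNonarchimedeanLocalField F] in
/-- **The big-cell quadratic**: `(n⁻(σ)⁻¹ X n⁻(σ))₁₀ = X₁₀ + σ (X₁₁ − X₀₀) − σ² X₀₁`. [cite: HarishChandra1999AdmissibleDistributions, §7] -/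
theorem lowerUni_inv_conj_apply_one_zero (σ : F) (X : Matrix (Fin 2) (Fin 2) F) :
    ((((Matrix.GeneralLinearGroup.mkOfDetNeZero (!![1, 0; σ, 1] : Matrix (Fin 2) (Fin 2) F) (det_lowerUni_ne_zero σ))⁻¹ : GL (Fin 2) F) :
        Matrix (Fin 2) (Fin 2) F) * X *
        ((Matrix.GeneralLinearGroup.mkOfDetNeZero (!![1, 0; σ, 1] : Matrix (Fin 2) (Fin 2) F) (det_lowerUni_ne_zero σ) : GL (Fin 2) F) :
          Matrix (Fin 2) (Fin 2) F)) 1 0 = X 1 0 + σ * (X 1 1 - X 0 0) - σ ^ 2 * X 0 1 := by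
  rw [coe_lowerUni_inv]
  show ((!![1, 0; -σ, 1] : Matrix (Fin 2) (Fin 2) F) * X * !![1, 0; σ, 1]) 1 0 = _
  simp only [Matrix.mul_apply, Fin.sum_univ_two, Matrix.of_apply, Matrix.cons_val', Matrix.cons_val_zero, Matrix.cons_val_one,
    Matrix.empty_val', Matrix.cons_val_fin_one]
  ring

omit [ValuativeRel F] [TopologicalSpace F] [IsNonarchimedeanLocalField F] in
/-- **The small-cell quadratic**: `(m_t⁻¹ X m_t)₁₀ = X₀₁ + t (X₀₀ − X₁₁) − t² X₁₀`. [cite: HarishChandra1999AdmissibleDistributions, §7] -/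
theorem swapT_inv_conj_apply_one_zero (t : F) (X : Matrix (Fin 2) (Fin 2) F) :
    ((((Matrix.GeneralLinearGroup.mkOfDetNeZero (!![t, 1; 1, 0] : Matrix (Fin 2) (Fin 2) F) (det_swapT_ne_zero t))⁻¹ : GL (Fin 2) F) :
        Matrix (Fin 2) (Fin 2) F) * X *
        ((Matrix.GeneralLinearGroup.mkOfDetNeZero (!![t, 1; 1, 0] : Matrix (Fin 2) (Fin 2) F) (det_swapT_ne_zero t) : GL (Fin 2) F) :
          Matrix (Fin 2) (Fin 2) F)) 1 0 = X 0 1 + t * (X 0 0 - X 1 1) - t ^ 2 * X 1 0 := by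
  rw [coe_swapT_inv]
  show ((!![0, 1; 1, -t] : Matrix (Fin 2) (Fin 2) F) * X * !![t, 1; 1, 0]) 1 0 = _
  simp only [Matrix.mul_apply, Fin.sum_univ_two, Matrix.of_apply, Matrix.cons_val', Matrix.cons_val_zero, Matrix.cons_val_one,
    Matrix.empty_val', Matrix.cons_val_fin_one]
  ring

omit [ValuativeRel F] [TopologicalSpace F] [IsNonarchimedeanLocalField F] in
/-- `det n⁻(σ) = 1`. [folklore] -/
theorem det_coe_lowerUni (σ : F) :
    (((Matrix.GeneralLinearGroup.mkOfDetNeZero (!![1, 0; σ, 1] : Matrix (Fin 2) (Fin 2) F) (det_lowerUni_ne_zero σ) : GL (Fin 2) F) :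
        Matrix (Fin 2) (Fin 2) F)).det = 1 := by
  show (!![1, 0; σ, 1] : Matrix (Fin 2) (Fin 2) F).det = 1
  rw [Matrix.det_fin_two_of]; ring

omit [ValuativeRel F] [TopologicalSpace F] [IsNonarchimedeanLocalField F] in
/-- `det m_t = −1`. [folklore] -/
theorem det_coe_swapT (t : F) :
    (((Matrix.GeneralLinearGroup.mkOfDetNeZero (!![t, 1; 1, 0] : Matrix (Fin 2) (Fin 2) F) (det_swapT_ne_zero t) : GL (Fin 2) F) :
        Matrix (Fin 2) (Fin 2) F)).det = -1 := by
  show (!![t, 1; 1, 0] : Matrix (Fin 2) (Fin 2) F).det = -1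
  rw [Matrix.det_fin_two_of]; ring

/-! ## §2  Right `B(𝒪)`-invariance of `k ↦ Ω(det k, (k⁻¹ X k)₁₀)` -/

omit [ValuativeRel F] [TopologicalSpace F] [IsNonarchimedeanLocalField F] in
/-- Conjugating by an upper-triangular `b = [[α,β],[0,δ]]` multiplies the `(1,0)` entry by `α∕δ`: `(b⁻¹ Y b)₁₀ = (α∕δ) Y₁₀`. [folklore] -/
theorem borel_inv_conj_apply_one_zero (b : GL (Fin 2) F) (hb : (b : Matrix (Fin 2) (Fin 2) F) 1 0 = 0) (Y : Matrix (Fin 2) (Fin 2) F) :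
    (((b⁻¹ : GL (Fin 2) F) : Matrix (Fin 2) (Fin 2) F) * Y * (b : Matrix (Fin 2) (Fin 2) F)) 1 0 =
      (b : Matrix (Fin 2) (Fin 2) F) 0 0 / (b : Matrix (Fin 2) (Fin 2) F) 1 1 * Y 1 0 := by
  have hdet : (b : Matrix (Fin 2) (Fin 2) F).det ≠ 0 := (Matrix.isUnits_det_units b).ne_zero
  have hdet' : (b : Matrix (Fin 2) (Fin 2) F).det = (b : Matrix (Fin 2) (Fin 2) F) 0 0 * (b : Matrix (Fin 2) (Fin 2) F) 1 1 := by
    rw [Matrix.det_fin_two, hb, mul_zero, sub_zero]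
  have hα : (b : Matrix (Fin 2) (Fin 2) F) 0 0 ≠ 0 := by rw [hdet'] at hdet; exact left_ne_zero_of_mul hdet
  have hδ : (b : Matrix (Fin 2) (Fin 2) F) 1 1 ≠ 0 := by rw [hdet'] at hdet; exact right_ne_zero_of_mul hdet
  have hinv : ((b⁻¹ : GL (Fin 2) F) : Matrix (Fin 2) (Fin 2) F) =
      !![((b : Matrix (Fin 2) (Fin 2) F) 0 0)⁻¹, -(b : Matrix (Fin 2) (Fin 2) F) 0 1 / ((b : Matrix (Fin 2) (Fin 2) F) 0 0 * (b : Matrix (Fin 2) (Fin 2) F) 1 1);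
        0, ((b : Matrix (Fin 2) (Fin 2) F) 1 1)⁻¹] := by
    rw [Matrix.coe_units_inv]
    refine Matrix.inv_eq_left_inv ?_
    conv_lhs => rw [Matrix.eta_fin_two (b : Matrix (Fin 2) (Fin 2) F)]
    rw [hb, Matrix.mul_fin_two, Matrix.one_fin_two]
    ext i j
    fin_cases i <;> fin_cases j <;> simp [hα, hδ]
    field_simp
    ring
  rw [hinv]
  conv_lhs => rw [Matrix.eta_fin_two (b : Matrix (Fin 2) (Fin 2) F)]
  rw [hb]
  simp only [Matrix.mul_apply, Fin.sum_univ_two, Matrix.of_apply, Matrix.cons_val', Matrix.cons_val_zero, Matrix.cons_val_one,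
    Matrix.empty_val', Matrix.cons_val_fin_one]
  field_simp
  ring

section Cells
variable [MeasurableSpace F] [BorelSpace F] (dx : Measure F) [dx.IsAddHaarMeasure]
  [MeasurableSpace (GL (Fin 2) F)] [BorelSpace (GL (Fin 2) F)]

/-- **THE `K`-AVERAGE OF A (det, entry)-WEIGHT OVER THE BRUHAT CELLS.**  For `κ` Haar on `K = GL₂(𝒪)` and `dx` additive Haar on `F` there is ONE constant
`c ∈ (0,∞)` (the cell constant of ★ p857099) such that for every measurable `Ω : F → F → ℝ≥0∞` with `Ω (d·u) (v·s) = Ω d s` whenever `u, v ∈ 𝒪ˣ` with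
`u·v` a square, and every `X ∈ 𝔤𝔩₂(F)`:
`∫⁻_K Ω(det k, (k⁻¹ X k)₁₀) dκ = c · (∫⁻_{σ ∈ 𝒪} Ω(1, X₁₀ + σ(X₁₁ − X₀₀) − σ²X₀₁) dσ + ∫⁻_{t ∈ 𝔭} Ω(−1, X₀₁ + t(X₀₀ − X₁₁) − t²X₁₀) dt)`.
[cite: HarishChandra1999AdmissibleDistributions, §7] [cite: Gelbart1975, Remark 9.23] -/
theorem lintegral_glInt_detEntryWeight_eq_cells (κ : Measure ↥(glInt 2 F)) [κ.IsHaarMeasure] :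
    ∃ c : ℝ≥0∞, c ≠ 0 ∧ c ≠ ⊤ ∧ ∀ Ω : F → F → ℝ≥0∞, Measurable (Function.uncurry Ω) →
      (∀ (d s : F) (u v : Fˣ), normAbs F (u : F) = 1 → normAbs F (v : F) = 1 → IsSquare (u * v) → Ω (d * u) (v * s) = Ω d s) →
      ∀ X : Matrix (Fin 2) (Fin 2) F,
        ∫⁻ k, Ω (((k : GL (Fin 2) F) : Matrix (Fin 2) (Fin 2) F)).det
            ((((((k : GL (Fin 2) F))⁻¹ : GL (Fin 2) F) : Matrix (Fin 2) (Fin 2) F) * X * ((k : GL (Fin 2) F) : Matrix (Fin 2) (Fin 2) F)) 1 0) ∂κ =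
          c * ((∫⁻ σ in primePowBall F 0, Ω 1 (X 1 0 + σ * (X 1 1 - X 0 0) - σ ^ 2 * X 0 1) ∂dx) +
            ∫⁻ t in primePowBall F 1, Ω (-1) (X 0 1 + t * (X 0 0 - X 1 1) - t ^ 2 * X 1 0) ∂dx) := by
  haveI : T2Space F := (isLocalField F).toT2Space
  haveI : IsTopologicalRing F := inferInstance
  obtain ⟨c, hc0, hct, hA⟩ := lintegral_glInt_eq_bruhatCells_mkOfDetNeZero κ dx
  refine ⟨c, hc0, hct, fun Ω hΩm hΩ X => ?_⟩
  -- the function on all of `GL₂(F)`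
  set Ψ : GL (Fin 2) F → ℝ≥0∞ := fun x => Ω ((x : Matrix (Fin 2) (Fin 2) F)).det
    ((((x⁻¹ : GL (Fin 2) F) : Matrix (Fin 2) (Fin 2) F) * X * (x : Matrix (Fin 2) (Fin 2) F)) 1 0) with hΨ
  have hΨm : Measurable Ψ := by
    refine hΩm.comp (Measurable.prodMk ?_ ?_)
    · exact (Continuous.matrix_det Units.continuous_val).measurable
    · exact ((continuous_id.matrix_elem 1 0).comp ((Units.continuous_coe_inv.mul continuous_const).mul Units.continuous_val)).measurable
  -- right `B(𝒪)`-invariance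
  have hΨinv : ∀ k ∈ glInt 2 F, ∀ b ∈ glInt 2 F, ((b : GL (Fin 2) F) : Matrix (Fin 2) (Fin 2) F) 1 0 = 0 → Ψ (k * b) = Ψ k := by
    intro k _ b hb hb10
    have hdet := valuation_det_eq_one_of_mem_glInt hb
    rw [Matrix.det_fin_two, hb10, mul_zero, sub_zero, map_mul] at hdet
    have hle := valuation_apply_le_one hb
    have h00 : valuation F (((b : GL (Fin 2) F) : Matrix (Fin 2) (Fin 2) F) 0 0) = 1 :=
      valuation_eq_one_of_mul_eq_one (hle 0 0) (hle 1 1) hdet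
    have h11 : valuation F (((b : GL (Fin 2) F) : Matrix (Fin 2) (Fin 2) F) 1 1) = 1 :=
      valuation_eq_one_of_mul_eq_one (hle 1 1) (hle 0 0) (by rw [mul_comm]; exact hdet)
    have hα0 : ((b : GL (Fin 2) F) : Matrix (Fin 2) (Fin 2) F) 0 0 ≠ 0 := fun h => by rw [h, map_zero] at h00; exact zero_ne_one h00
    have hδ0 : ((b : GL (Fin 2) F) : Matrix (Fin 2) (Fin 2) F) 1 1 ≠ 0 := fun h => by rw [h, map_zero] at h11; exact zero_ne_one h11
    set α : Fˣ := Units.mk0 _ hα0 with hαdef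
    set δ : Fˣ := Units.mk0 _ hδ0 with hδdef
    simp only [hΨ]
    have hconj : (((k * b)⁻¹ : GL (Fin 2) F) : Matrix (Fin 2) (Fin 2) F) * X * ((k : Matrix (Fin 2) (Fin 2) F) * (b : Matrix (Fin 2) (Fin 2) F)) =
        ((b⁻¹ : GL (Fin 2) F) : Matrix (Fin 2) (Fin 2) F) * ((((k⁻¹ : GL (Fin 2) F) : Matrix (Fin 2) (Fin 2) F) * X * (k : Matrix (Fin 2) (Fin 2) F))) *
          (b : Matrix (Fin 2) (Fin 2) F) := by
      rw [mul_inv_rev, Units.val_mul]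
      simp only [Matrix.mul_assoc]
    rw [Units.val_mul, Matrix.det_mul, hconj, borel_inv_conj_apply_one_zero b hb10]
    have hdetb : ((b : GL (Fin 2) F) : Matrix (Fin 2) (Fin 2) F).det = (α : F) * (δ : F) := by
      rw [Matrix.det_fin_two, hb10, mul_zero, sub_zero]; rfl
    rw [hdetb, show ((b : GL (Fin 2) F) : Matrix (Fin 2) (Fin 2) F) 0 0 / ((b : GL (Fin 2) F) : Matrix (Fin 2) (Fin 2) F) 1 1 = ((α * δ⁻¹ : Fˣ) : F) by
      simp [hαdef, hδdef, div_eq_mul_inv], show (α : F) * (δ : F) = ((α * δ : Fˣ) : F) by rw [Units.val_mul]]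
    refine hΩ _ _ (α * δ) (α * δ⁻¹) ?_ ?_ ⟨α, by rw [mul_mul_mul_comm, mul_inv_cancel, mul_one]⟩
    · rw [Units.val_mul, map_mul, show (α : F) = ((b : GL (Fin 2) F) : Matrix (Fin 2) (Fin 2) F) 0 0 from rfl,
        show (δ : F) = ((b : GL (Fin 2) F) : Matrix (Fin 2) (Fin 2) F) 1 1 from rfl, normAbs_eq_one_iff_valuation_eq_one.2 h00,
        normAbs_eq_one_iff_valuation_eq_one.2 h11, mul_one]
    · rw [Units.val_mul, Units.val_inv_eq_inv_val, map_mul, map_inv₀, show (α : F) = ((b : GL (Fin 2) F) : Matrix (Fin 2) (Fin 2) F) 0 0 from rfl,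
        show (δ : F) = ((b : GL (Fin 2) F) : Matrix (Fin 2) (Fin 2) F) 1 1 from rfl, normAbs_eq_one_iff_valuation_eq_one.2 h00,
        normAbs_eq_one_iff_valuation_eq_one.2 h11, inv_one, mul_one]
  have h := hA Ψ hΨm hΨinv
  simp only [hΨ, lowerUni_inv_conj_apply_one_zero, swapT_inv_conj_apply_one_zero, det_coe_lowerUni, det_coe_swapT] at h
  exact h

end Cells

end Summit.HodgeConjecture.HodgeConjecture.Cruxes.H413.K2E3GL2TwistedWeightCells

end
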